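import Literature.AlgebraicGeometry.AbelianSchemes.LevelStructureLocus
import Literature.AlgebraicGeometry.AbelianSchemes.DescendedHomBaseChangeComp
import Literature.AlgebraicGeometry.Limits.LocalizationProdLimit
import HarnessLib

/-!
# Spreading a level structure from the generic fibre to a stage `D(t)` — the stage lemmas
# (EGA IV₃ 8.8.2 (i) for sections; MFK Prop. 7.3 step (IV) + Stacks 01Z3 for the basis clause)

Topic `Literature/AlgebraicGeometry/AbelianSchemes`; namespace `Literature.AlgebraicGeometry.AbelianSchemes.AbelianSchemeOver`.
THEOREMS ONLY (no definition, no named fact, no instance, no notation, no `sorry`; net Literature debt 0).  Cell `hodgecm-mathlib`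
(D-0151), programme F0/P6 «MOD», SPREAD door (LEAD M-17m), organ **(SP2) «spread of a level structure»** (REP-S census §2 row `lvl`,
§4); FILE 1 of 2 (FILE 2 = `LevelStructureSpread`, the head).  `--supports stmt-HodgeConjecture-24832`, count-neutral.  HONEST LABEL:
HC_CM is proved only modulo the 2 remaining named inputs (hLiu418 24832, h413 24833) until rung 0 closes; this file discharges none of
them.

SETTING (the tree's localisation-limit currency ★ `Limits/LocalizationDiagram`, ★ `Limits/LocalizationProdLimit`, namespace
`…Limits.LocApprox`): `A` a ring, `S ⊆ A` a submonoid, `B = A_S` (`[IsLocalization S B]`), `P → Spec A` an `A`-scheme, the STAGES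
`P ⊗ D(t) = P ×_A Spec A[1∕t]` (`(baseDiagram S).obj t`, `t : Idx S`, ordered by divisibility), the GENERIC FIBRE `P ⊗ specOver A B`
`= lim_t P ⊗ D(t)` (★ `isLimitProdCone`) with cone legs `P ◁ (baseCone S B).π.app t`, and an abelian scheme `𝒜 → P`
(★ `AbelianSchemeOver P.left`) or `𝒞 → P ⊗ D(s)` over a stage.  Sections of base changes are the tree's ★ `Sections`,
★ `sectionBaseChange` ([MumfordFogartyKirwan1994] Def. 7.2's `σᵢ ×_S T`).

* §0 the legs and transitions lie over `P` and compose (on underlying schemes);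
* §1 **`exists_stage_hom_of_generic`** / `exists_stage_homs_of_generic` — a `P`-morphism (finitely many) `P ⊗ Spec A_S → 𝒜` is the
  restriction of a `P`-morphism `P ⊗ D(t) → 𝒜` ([EGAIV3] 8.8.2 (i) = [GortzWedhorn2020] Thm. 10.57, through ★
  `LocApprox.exists_whiskerLeft_comp_eq` / `exists_whiskerLeft_map_comp_eq` with target `𝒜 → P → Spec A`, locally of finite presentation);
* §2 `exists_section(s)_left_comp_fst_eq` — a morphism over `f : T → X` IS a section of `𝒜 ×_X T`;
  **`LevelStructure.exists_baseChange_baseChange_of_left_comp_fst`** — a level structure on `𝒜 ×_X T` (`b = v ≫ j`) whose sections read in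
  `𝒜` are `v ≫ τᵢ` IS (after ★ `baseChangeCompGrpIso`, ★ `LevelStructure.exists_comp_of_iso`) a level structure on `(𝒜 ×_X T₁) ×_{T₁} T`
  with sections `τᵢ ×_{T₁} T` — the generic level structure re-read as the pull-back of stage sections;
* §3 **`exists_stage_sectionBaseChange_pow_eq_one`** — `N`-torsion on the generic fibre ⟹ `N`-torsion at a finer stage (8.8.2 (i),
  uniqueness half, through ★ `sectionBaseChange_pow_eq_one_iff_comp_left_eq`);
* §4 **`exists_stage_forall_injective`** — injectivity of `a ↦ σ^a` at every geometric point of the generic fibre ⟹ at every geometric point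
  of a finer stage: the injectivity locus is OPEN (★ `isOpen_setOf_forall_injective_restrict_sectionPow`, [MumfordFogartyKirwan1994]
  Prop. 7.3 step (IV)) and contains the image of the limit, hence the image of a stage (Mathlib `exists_map_eq_top`, Stacks 01Z3 —
  NO density / flatness hypothesis on `P`);
* §5 `exists_idx_forall_isUnit_algebraMap_loc` — a unit of `A_S` is a unit of some `A[1∕m]`; `natCast_residueField_ne_zero_of_isUnit(_loc)` —
  hence `N ≠ 0` in every residue field of a scheme over `Spec A[1∕t]`, `m ∣ t` (the hypothesis of ★ `exists_levelStructure_of_injective`).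

## References
* [EGAIV3] A. Grothendieck, J. Dieudonné, EGA IV₃ (Publ. Math. IHÉS 28, 1966), Thm. 8.8.2 (i), §8.3.
* [GortzWedhorn2020] U. Görtz, T. Wedhorn, *Algebraic Geometry I*, 2nd ed. (2020), §(10.13) pp. 261–262, Thm. 10.57 p. 264, Cor. 10.64 p. 267,
  Section (4.7) pp. 107–108, Prop. 4.16 p. 101.
* [MumfordFogartyKirwan1994] D. Mumford, J. Fogarty, F. Kirwan, *Geometric Invariant Theory*, 3rd ed. (1994), Ch. 7 §2 Definitions 7.1–7.2
  (p. 129), Proposition 7.3, proof, step (IV) (pp. 133–134).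
* [StacksProject] The Stacks Project, Tags 01ZC (morphisms of finite presentation and limits), 01Z3 (limits of schemes).
-/

set_option autoImplicit false

noncomputable section

universe u

open CategoryTheory CategoryTheory.Limits AlgebraicGeometry MonoidalCategory CartesianMonoidalCategory
open scoped MonObj

namespace Literature.AlgebraicGeometry.AbelianSchemes

namespace AbelianSchemeOver

open Literature.AlgebraicGeometry.Motives (SchemeOver specOver)
open Literature.AlgebraicGeometry.Limits Literature.AlgebraicGeometry.Limits.LocApprox

set_option backward.isDefEq.respectTransparency false

variable {A : Type u} [CommRing A] {S : Submonoid A} {B : Type u} [CommRing B] [Algebra A B] [IsLocalization S B]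
variable {P : SchemeOver A}

/-! ### §0 Plumbing: the stages `P|_{D(t)} = P ⊗ Spec A[1∕t]`, the generic fibre `P ⊗ Spec A_S`, the cone legs -/

/-- The cone leg `P ⊗ Spec A_S → P ⊗ D(t)` lies over `P`. [cite: GortzWedhorn2020, §(10.13) (pp. 261–262) and Section (4.7) (pp. 107–108)] -/
theorem whiskerLeft_π_left_comp_fst_left (t : Idx S) :
    (P ◁ (baseCone S B).π.app t).left ≫ (fst P ((baseDiagram S).obj t)).left = (fst P (specOver A B)).left := by
  rw [← Over.comp_left, whiskerLeft_fst]
  rfl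

/-- The transition `P ⊗ D(t) → P ⊗ D(s)` lies over `P`. [cite: GortzWedhorn2020, §(10.13) (pp. 261–262) and Section (4.7) (pp. 107–108)] -/
theorem whiskerLeft_map_left_comp_fst_left {t s : Idx S} (f : t ⟶ s) :
    (P ◁ (baseDiagram S).map f).left ≫ (fst P ((baseDiagram S).obj s)).left =
      (fst P ((baseDiagram S).obj t)).left := by
  rw [← Over.comp_left, whiskerLeft_fst]

/-- The cone legs are compatible with the transitions (on underlying schemes). [cite: GortzWedhorn2020, §(10.13) (pp. 261–262)] -/
theorem whiskerLeft_π_left_comp_map_left {t s : Idx S} (f : t ⟶ s) :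
    (P ◁ (baseCone S B).π.app t).left ≫ (P ◁ (baseDiagram S).map f).left = (P ◁ (baseCone S B).π.app s).left := by
  rw [← Over.comp_left, ← MonoidalCategory.whiskerLeft_comp, Cone.w]

/-- Transitions compose (on underlying schemes). [cite: GortzWedhorn2020, §(10.13) (pp. 261–262)] -/
theorem whiskerLeft_map_left_comp_map_left {r t s : Idx S} (h : r ⟶ t) (f : t ⟶ s) :
    (P ◁ (baseDiagram S).map h).left ≫ (P ◁ (baseDiagram S).map f).left = (P ◁ (baseDiagram S).map (h ≫ f)).left := by
  rw [← Over.comp_left, ← MonoidalCategory.whiskerLeft_comp, Functor.map_comp]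

/-! ### §1 Morphisms into an abelian scheme over `P` spread from the generic fibre to a stage (EGA IV₃ 8.8.2 (i)) -/

section HomSpread

variable [QuasiCompact P.hom] [QuasiSeparated P.hom] [LocallyOfFinitePresentation P.hom]
variable (B) (𝒜 : AbelianSchemeOver P.left)

/-- **A `P`-morphism `P ⊗ Spec A_S → 𝒜` spreads to a `P`-morphism `P ⊗ D(t) → 𝒜`** (`𝒜 → P → Spec A` is locally of
finite presentation; Stacks 01ZC over ★ `isLimitProdCone`, then the «over `P`» identity at a finer stage).
[cite: GortzWedhorn2020, Thm. 10.57 / Cor. 10.64 (pp. 264–267)] [cite: StacksProject, Tag 01ZC] -/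
theorem exists_stage_hom_of_generic (u : (P ⊗ specOver A B).left ⟶ 𝒜.X.left)
    (hu : u ≫ 𝒜.X.hom = (fst P (specOver A B)).left) :
    ∃ (t : Idx S) (ut : (P ⊗ (baseDiagram S).obj t).left ⟶ 𝒜.X.left),
      ut ≫ 𝒜.X.hom = (fst P ((baseDiagram S).obj t)).left ∧ (P ◁ (baseCone S B).π.app t).left ≫ ut = u := by
  haveI := 𝒜.isSmooth
  -- `𝒜` as an `A`-scheme through `P`
  let X : SchemeOver A := Over.mk (𝒜.X.hom ≫ P.hom)
  haveI : LocallyOfFinitePresentation X.hom := by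
    change LocallyOfFinitePresentation (𝒜.X.hom ≫ P.hom)
    infer_instance
  let toP : X ⟶ P := Over.homMk 𝒜.X.hom rfl
  let a : P ⊗ specOver A B ⟶ X := Over.homMk u (by
    change u ≫ 𝒜.X.hom ≫ P.hom = _
    rw [reassoc_of% hu, Over.w])
  obtain ⟨s, g, hg⟩ := exists_whiskerLeft_comp_eq (S := S) B (P := P) (X := X) a
  -- the two maps `g ≫ toP`, `fst` to `P` agree at the limit, hence at a finer stage
  have hlim : (P ◁ (baseCone S B).π.app s) ≫ g ≫ toP = (P ◁ (baseCone S B).π.app s) ≫ fst _ _ := by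
    rw [reassoc_of% hg, whiskerLeft_fst]
    ext : 1
    exact hu
  obtain ⟨t, f, hf⟩ := exists_whiskerLeft_map_comp_eq (S := S) B (P := P) (X := P) (g ≫ toP) (fst _ _) hlim
  refine ⟨t, ((P ◁ (baseDiagram S).map f) ≫ g).left, ?_, ?_⟩
  · have := congrArg CommaMorphism.left hf
    simp only [Over.comp_left, whiskerLeft_fst] at this
    rw [Over.comp_left, Category.assoc]
    exact this
  · rw [← Over.comp_left, ← Category.assoc, ← MonoidalCategory.whiskerLeft_comp, Cone.w, hg]
    rfl

/-- **Finitely many `P`-morphisms spread to ONE stage.** [cite: GortzWedhorn2020, Cor. 10.64 (p. 267)] [cite: StacksProject, Tag 01ZC] -/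
theorem exists_stage_homs_of_generic {J : Type} [Finite J] (u : J → ((P ⊗ specOver A B).left ⟶ 𝒜.X.left))
    (hu : ∀ j, u j ≫ 𝒜.X.hom = (fst P (specOver A B)).left) :
    ∃ (t : Idx S) (ut : J → ((P ⊗ (baseDiagram S).obj t).left ⟶ 𝒜.X.left)),
      ∀ j, ut j ≫ 𝒜.X.hom = (fst P ((baseDiagram S).obj t)).left ∧ (P ◁ (baseCone S B).π.app t).left ≫ ut j = u j := by
  classical
  choose t ut hut using fun j => 𝒜.exists_stage_hom_of_generic (S := S) B (u j) (hu j)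
  haveI : Fintype J := Fintype.ofFinite J
  obtain ⟨t₀, ht₀⟩ := IsCofiltered.inf_objs_exists (Finset.univ.image t)
  have f : ∀ j, t₀ ⟶ t j := fun j => (ht₀ (Finset.mem_image_of_mem t (Finset.mem_univ j))).some
  refine ⟨t₀, fun j => (P ◁ (baseDiagram S).map (f j)).left ≫ ut j, fun j => ⟨?_, ?_⟩⟩
  · rw [Category.assoc, (hut j).1, whiskerLeft_map_left_comp_fst_left]
  · rw [← Category.assoc, whiskerLeft_π_left_comp_map_left, (hut j).2]

end HomSpread

/-! ### §2 Packaging: `P`-morphisms from a base `T → X` into `𝒜` as sections of `𝒜 ×_X T`; transport of the generic level structure -/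

section Package

variable {X : Scheme.{u}} (𝒜 : AbelianSchemeOver X)

/-- **A morphism `u : T → 𝒜` lying over `f : T → X` IS a section of `𝒜 ×_X T → T`** (the section `(u, 𝟙)`).
[cite: GortzWedhorn2020, Section (4.7), (4.7.1) (p. 108)] -/
theorem exists_section_left_comp_fst_eq {T : Scheme.{u}} (f : T ⟶ X) (u : T ⟶ 𝒜.X.left)
    (hu : u ≫ 𝒜.X.hom = f) :
    ∃ τ : (𝒜.baseChange f).Sections, τ.left ≫ pullback.fst 𝒜.X.hom f = u := by
  have hw : pullback.lift u (𝟙 T) (by rw [hu, Category.id_comp]) ≫ (𝒜.baseChange f).X.hom = (𝟙_ (Over T)).hom := by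
    rw [Over.tensorUnit_hom]
    exact pullback.lift_snd _ _ _
  exact ⟨Over.homMk _ hw, pullback.lift_fst _ _ _⟩

/-- **Finitely many morphisms over `f` are the sections of a family.** [cite: GortzWedhorn2020, Section (4.7), (4.7.1) (p. 108)] -/
theorem exists_sections_left_comp_fst_eq {T : Scheme.{u}} (f : T ⟶ X) {J : Type} (u : J → (T ⟶ 𝒜.X.left))
    (hu : ∀ j, u j ≫ 𝒜.X.hom = f) :
    ∃ τ : J → (𝒜.baseChange f).Sections, ∀ j, (τ j).left ≫ pullback.fst 𝒜.X.hom f = u j := by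
  choose τ hτ using fun j => 𝒜.exists_section_left_comp_fst_eq f (u j) (hu j)
  exact ⟨τ, hτ⟩

/-- **The generic level structure is the pull-back of the stage sections.**  For `b = v ≫ j` (`v` the cone leg, `j` the
stage projection to `X`), a level structure `φ` on `𝒜 ×_X T` (base change along `b`) whose sections, read in `𝒜`, are
the restrictions `v ≫ τᵢ` of sections `τᵢ` of `𝒜 ×_X T₁` moves along the comparison isomorphism of group schemes
`𝒜 ×_X T ≅ (𝒜 ×_X T₁) ×_{T₁} T` (★ `baseChangeCompGrpIso`, ★ `LevelStructure.exists_comp_of_iso`) to a level structure on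
`(𝒜 ×_X T₁) ×_{T₁} T` whose sections ARE the pulled-back sections `τᵢ ×_{T₁} T` (★ `sectionBaseChange_eq_of_left_comp_fst`).
[cite: MumfordFogartyKirwan1994, Ch. 7 §2 Definitions 7.1–7.2 (p. 129)] [cite: GortzWedhorn2020, Section (4.7) (pp. 107–108)] -/
theorem LevelStructure.exists_baseChange_baseChange_of_left_comp_fst {g N : ℕ} {T₁ T : Scheme.{u}} (j : T₁ ⟶ X)
    (v : T ⟶ T₁) {b : T ⟶ X} (hb : b = v ≫ j) (φ : LevelStructure g N (𝒜.baseChange b))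
    (τ : Fin g ⊕ Fin g → (𝒜.baseChange j).Sections)
    (hτ : ∀ i, v ≫ (τ i).left ≫ pullback.fst 𝒜.X.hom j = (φ.σ i).left ≫ pullback.fst 𝒜.X.hom b) :
    ∃ φ₁ : LevelStructure g N ((𝒜.baseChange j).baseChange v), ∀ i, φ₁.σ i = (𝒜.baseChange j).sectionBaseChange v (τ i) := by
  subst hb
  haveI := 𝒜.isIso_baseChangeCompGrpIso_hom_hom_hom j v
  haveI : IsMonHom (asIso (𝒜.baseChangeCompGrpIso j v).hom.hom.hom).hom := by
    change IsMonHom (𝒜.baseChangeCompGrpIso j v).hom.hom.hom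
    infer_instance
  obtain ⟨φ₁, hφ₁⟩ := LevelStructure.exists_comp_of_iso (asIso (𝒜.baseChangeCompGrpIso j v).hom.hom.hom) φ
  refine ⟨φ₁, fun i => ?_⟩
  rw [hφ₁ i]
  symm
  apply (𝒜.baseChange j).sectionBaseChange_eq_of_left_comp_fst v
  change ((φ.σ i).left ≫ (𝒜.baseChangeCompGrpIso j v).hom.hom.hom.left) ≫ pullback.fst (pullback.snd 𝒜.X.hom j) v =
    v ≫ (τ i).left
  apply pullback.hom_ext
  · rw [Category.assoc, Category.assoc, Category.assoc, 𝒜.baseChangeCompGrpIso_hom_left_fst_fst j v, ← hτ i]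
  · have h1 : (φ.σ i).left ≫ pullback.snd 𝒜.X.hom (v ≫ j) = 𝟙 T := by
      rw [← Over.tensorUnit_hom (X := T)]
      exact Over.w (φ.σ i)
    have h2 : (τ i).left ≫ pullback.snd 𝒜.X.hom j = 𝟙 T₁ := by
      rw [← Over.tensorUnit_hom (X := T₁)]
      exact Over.w (τ i)
    rw [Category.assoc, Category.assoc, Category.assoc, pullback.condition,
      𝒜.baseChangeCompGrpIso_hom_left_snd_assoc j v, reassoc_of% h1, h2, Category.comp_id]
    exact Category.id_comp v

end Package

/-! ### §3 The torsion identities hold at a finer stage (EGA IV₃ 8.8.2 (i), uniqueness half) -/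

section Torsion

variable (B)

omit [IsLocalization S B] in
/-- The stages `P ⊗ D(s) → Spec A` are locally of finite type. [cite: GortzWedhorn2020, Prop. 10.35 / (10.13)] -/
theorem locallyOfFiniteType_tensorObj_baseDiagram_hom [LocallyOfFiniteType P.hom] (s : Idx S) :
    LocallyOfFiniteType (P ⊗ (baseDiagram S).obj s).hom := by
  change LocallyOfFiniteType (pullback.fst P.hom ((baseDiagram S).obj s).hom ≫ P.hom)
  infer_instance

/-- **Two morphisms from a stage into a scheme locally of finite type over the stage which agree on the generic fibre
agree at a finer stage** (the form used below: the target is an abelian scheme `𝒞` over `P ⊗ D(s)`).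
[cite: GortzWedhorn2020, Thm. 10.57 (p. 264)] [cite: StacksProject, Tag 01ZC] -/
theorem exists_stage_comp_eq_of_π_comp_eq [QuasiCompact P.hom] [LocallyOfFiniteType P.hom] {s : Idx S}
    (𝒞 : AbelianSchemeOver (P ⊗ (baseDiagram S).obj s).left)
    (g₁ g₂ : (P ⊗ (baseDiagram S).obj s).left ⟶ 𝒞.X.left) (h₁ : g₁ ≫ 𝒞.X.hom = 𝟙 _) (h₂ : g₂ ≫ 𝒞.X.hom = 𝟙 _)
    (h : (P ◁ (baseCone S B).π.app s).left ≫ g₁ = (P ◁ (baseCone S B).π.app s).left ≫ g₂) :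
    ∃ (t : Idx S) (f : t ⟶ s), (P ◁ (baseDiagram S).map f).left ≫ g₁ = (P ◁ (baseDiagram S).map f).left ≫ g₂ := by
  haveI := 𝒞.isSmooth
  haveI := locallyOfFiniteType_tensorObj_baseDiagram_hom (P := P) s
  let X : SchemeOver A := Over.mk (𝒞.X.hom ≫ (P ⊗ (baseDiagram S).obj s).hom)
  haveI : LocallyOfFiniteType X.hom := by
    change LocallyOfFiniteType (𝒞.X.hom ≫ (P ⊗ (baseDiagram S).obj s).hom)
    infer_instance
  let a₁ : P ⊗ (baseDiagram S).obj s ⟶ X := Over.homMk g₁ (by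
    change g₁ ≫ 𝒞.X.hom ≫ _ = _
    rw [reassoc_of% h₁])
  let a₂ : P ⊗ (baseDiagram S).obj s ⟶ X := Over.homMk g₂ (by
    change g₂ ≫ 𝒞.X.hom ≫ _ = _
    rw [reassoc_of% h₂])
  obtain ⟨t, f, hf⟩ := exists_whiskerLeft_map_comp_eq (S := S) B (P := P) (X := X) a₁ a₂ (by ext : 1; exact h)
  exact ⟨t, f, congrArg CommaMorphism.left hf⟩

/-- **`N`-torsion at the limit ⟹ `N`-torsion at a finer stage**: if the sections `τⱼ ×_{P|D(s)} (P ⊗ Spec A_S)` are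
`N`-torsion, then so are the `τⱼ ×_{P|D(s)} P|_{D(t)}` for some finer stage `t` (finitely many `j`).
[cite: MumfordFogartyKirwan1994, Ch. 7 §2 Definition 7.1 (ii) (p. 129)] [cite: GortzWedhorn2020, Thm. 10.57 (p. 264)] -/
theorem exists_stage_sectionBaseChange_pow_eq_one [QuasiCompact P.hom] [LocallyOfFiniteType P.hom] {s : Idx S}
    (𝒞 : AbelianSchemeOver (P ⊗ (baseDiagram S).obj s).left) {J : Type} [Finite J] (τ : J → 𝒞.Sections) (N : ℕ)
    (h : ∀ j, 𝒞.sectionBaseChange (P ◁ (baseCone S B).π.app s).left (τ j) ^ N = 1) :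
    ∃ (t : Idx S) (f : t ⟶ s), ∀ j, 𝒞.sectionBaseChange (P ◁ (baseDiagram S).map f).left (τ j) ^ N = 1 := by
  classical
  have hsec : ∀ σ : 𝒞.Sections, σ.left ≫ 𝒞.X.hom = 𝟙 (P ⊗ (baseDiagram S).obj s).left := fun σ => by
    have hw := Over.w σ
    rw [Over.tensorUnit_hom] at hw
    exact hw
  have key : ∀ j, ∃ (t : Idx S) (f : t ⟶ s),
      (P ◁ (baseDiagram S).map f).left ≫ (τ j ^ N).left = (P ◁ (baseDiagram S).map f).left ≫ (1 : 𝒞.Sections).left :=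
    fun j => exists_stage_comp_eq_of_π_comp_eq B 𝒞 _ _ (hsec _) (hsec _)
      ((𝒞.sectionBaseChange_pow_eq_one_iff_comp_left_eq _ (τ j) N).1 (h j))
  choose t f hf using key
  haveI : Fintype J := Fintype.ofFinite J
  obtain ⟨t₀, ht₀⟩ := IsCofiltered.inf_objs_exists (insert s (Finset.univ.image t))
  have F : t₀ ⟶ s := (ht₀ (Finset.mem_insert_self s _)).some
  have k : ∀ j, t₀ ⟶ t j := fun j =>
    (ht₀ (Finset.mem_insert_of_mem (Finset.mem_image_of_mem t (Finset.mem_univ j)))).some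
  refine ⟨t₀, F, fun j => ?_⟩
  rw [𝒞.sectionBaseChange_pow_eq_one_iff_comp_left_eq _ (τ j) N, show F = k j ≫ f j from Subsingleton.elim _ _,
    ← whiskerLeft_map_left_comp_map_left, Category.assoc, Category.assoc, hf j]

end Torsion

/-! ### §4 Injectivity on geometric fibres holds at a finer stage (MFK Prop. 7.3 step (IV) + Stacks 01Z3) -/

section Injective

variable (B)

/-- **Injectivity of `a ↦ σ^a` on geometric fibres spreads from the generic fibre to a stage.**  If the pulled-back family
`σᵢ ×_{P|D(s)} (P ⊗ Spec A_S)` is injective on `(ℤ∕N)^{2g}` at every geometric point of the generic fibre, then for some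
finer stage `t` the family `σᵢ ×_{P|D(s)} P|_{D(t)}` is injective at every geometric point of `P|_{D(t)}`: the
injectivity locus `U ⊆ P|_{D(s)}` is OPEN (★ `isOpen_setOf_forall_injective_restrict_sectionPow`), contains the image of
the limit `P ⊗ Spec A_S = lim_t P|_{D(t)}` (★ `isLimitProdCone`), hence contains the image of some `P|_{D(t)}` (Mathlib
`exists_map_eq_top`, Stacks 01Z3 — no density hypothesis). [cite: MumfordFogartyKirwan1994, Ch. 7 §2 Proposition 7.3, proof, step (IV) (pp. 133–134)]
[cite: StacksProject, Tag 01Z3] -/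
theorem exists_stage_forall_injective [QuasiCompact P.hom] {s : Idx S}
    (𝒞 : AbelianSchemeOver (P ⊗ (baseDiagram S).obj s).left) {g N : ℕ} [NeZero N] (σ : Fin g ⊕ Fin g → 𝒞.Sections)
    (h : ∀ ⦃Ω : Type u⦄ [Field Ω] [IsAlgClosed Ω] (x : Spec (.of Ω) ⟶ (P ⊗ specOver A B).left),
      Function.Injective fun a : Fin g ⊕ Fin g → ZMod N =>
        (𝒞.baseChange (P ◁ (baseCone S B).π.app s).left).restrict x
          ((𝒞.baseChange (P ◁ (baseCone S B).π.app s).left).sectionPow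
            (fun i => 𝒞.sectionBaseChange (P ◁ (baseCone S B).π.app s).left (σ i)) a)) :
    ∃ (t : Idx S) (f : t ⟶ s), ∀ ⦃Ω : Type u⦄ [Field Ω] [IsAlgClosed Ω] (x : Spec (.of Ω) ⟶ (P ⊗ (baseDiagram S).obj t).left),
      Function.Injective fun a : Fin g ⊕ Fin g → ZMod N =>
        (𝒞.baseChange (P ◁ (baseDiagram S).map f).left).restrict x
          ((𝒞.baseChange (P ◁ (baseDiagram S).map f).left).sectionPow
            (fun i => 𝒞.sectionBaseChange (P ◁ (baseDiagram S).map f).left (σ i)) a) := by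
  -- the open injectivity locus
  let U : ((P ⊗ (baseDiagram S).obj s).left).Opens :=
    ⟨{y | ∀ ⦃Ω : Type u⦄ [Field Ω] (x : Spec (.of Ω) ⟶ (P ⊗ (baseDiagram S).obj s).left),
        x (IsLocalRing.closedPoint Ω) = y → Function.Injective fun a : Fin g ⊕ Fin g → ZMod N =>
          𝒞.restrict x (𝒞.sectionPow σ a)}, 𝒞.isOpen_setOf_forall_injective_restrict_sectionPow σ⟩
  have hlim : Set.range (P ◁ (baseCone S B).π.app s).left ⊆ (U : Set _) :=
    (𝒞.forall_injective_restrict_sectionPow_baseChange_iff_range_subset σ _).1 h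
  have hlim' : (prodCone S B P).π.app s ⁻¹ᵁ U = ⊤ := by
    rw [prodCone_π_app]
    ext y
    simp only [TopologicalSpace.Opens.map_coe, Set.mem_preimage, TopologicalSpace.Opens.coe_top, Set.mem_univ,
      iff_true]
    exact hlim ⟨y, rfl⟩
  obtain ⟨t, f, hf⟩ := exists_map_eq_top (prodDiagram S P) (prodCone S B P) (isLimitProdCone S B P) U hlim'
  refine ⟨t, f, (𝒞.forall_injective_restrict_sectionPow_baseChange_iff_range_subset σ _).2 ?_⟩
  rintro _ ⟨y, rfl⟩
  have hy : y ∈ (((prodDiagram S P).map f ⁻¹ᵁ U : ((prodDiagram S P).obj t).Opens) : Set ((prodDiagram S P).obj t)) := by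
    rw [hf]; trivial
  exact hy

end Injective

/-! ### §5 `N` invertible on `Spec A_S` ⟹ `N` invertible on a stage, and on every scheme over it -/

section Invertible

/-- **A unit of `A_S` is a unit of some `A[1∕m]`**: if `N` is invertible in `B = A_S` then `N ∣ m` for some `m ∈ S`, so
that `N` is invertible in `A[1∕t]` for every `t ∈ S` with `m ∣ t`. [cite: GortzWedhorn2020, §(10.13) (pp. 261–262)] -/
theorem exists_idx_forall_isUnit_algebraMap_loc (N : ℕ) (hN : IsUnit ((N : ℕ) : B)) :
    ∃ m : Idx S, ∀ t : Idx S, t ≤ m → IsUnit (algebraMap A (loc S t) N) := by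
  obtain ⟨y, hy⟩ := hN.exists_right_inv
  obtain ⟨⟨a, c⟩, hac⟩ := IsLocalization.surj S y
  -- `N * a` and `c` agree in `B`
  have h1 : algebraMap A B ((N : A) * a) = algebraMap A B (c : A) := by
    rw [map_mul, map_natCast, ← hac, ← mul_assoc, hy, one_mul]
  obtain ⟨d, hd⟩ := (IsLocalization.eq_iff_exists S B).1 h1
  refine ⟨⟨d * c, S.mul_mem d.2 c.2⟩, fun t ht => ?_⟩
  -- `N * (d * a) = d * c` divides `t`, and `t` is a unit in `A[1/t]`
  obtain ⟨k, hk⟩ := Idx.le_iff.1 ht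
  have hdiv : (N : A) * ((d : A) * a * k) = t.val := by
    rw [hk]
    change (N : A) * ((d : A) * a * k) = (d : A) * (c : A) * k
    rw [← hd]; ring
  have ht' : IsUnit (algebraMap A (loc S t) t.val) := IsLocalization.Away.algebraMap_isUnit t.val
  exact isUnit_of_dvd_unit (map_dvd (algebraMap A (loc S t)) (Dvd.intro _ hdiv)) ht'

/-- **A unit in the global sections is nonzero in every residue field.** [cite: GortzWedhorn2020, Section (4.7), (4.7.1) (p. 108)] -/
theorem natCast_residueField_ne_zero_of_isUnit (Y : Scheme.{u}) (N : ℕ) (hN : IsUnit ((N : ℕ) : Γ(Y, ⊤))) (y : Y) :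
    (N : Y.residueField y) ≠ 0 := by
  have hu : IsUnit ((N : ℕ) : Y.residueField y) := by
    have := hN.map (Y.evaluation ⊤ y trivial).hom
    rwa [map_natCast] at this
  exact hu.ne_zero

/-- **`N` invertible on `A[1∕t]` ⟹ `N ≠ 0` in every residue field of a scheme over `Spec A[1∕t]`.**
[cite: GortzWedhorn2020, Section (4.7), (4.7.1) (p. 108)] -/
theorem natCast_residueField_ne_zero_of_isUnit_loc {t : Idx S} (N : ℕ)
    (hu : IsUnit (algebraMap A (loc S t) N)) (Y : Scheme.{u}) (q : Y ⟶ ((baseDiagram S).obj t).left) (y : Y) :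
    (N : Y.residueField y) ≠ 0 := by
  apply natCast_residueField_ne_zero_of_isUnit
  have h1 : IsUnit ((N : ℕ) : Γ(((baseDiagram S).obj t).left, ⊤)) := by
    have := hu.map (Scheme.ΓSpecIso (CommRingCat.of (loc S t))).inv.hom
    rwa [map_natCast, map_natCast] at this
  have := h1.map q.appTop.hom
  rwa [map_natCast] at this

end Invertible

end AbelianSchemeOver

end Literature.AlgebraicGeometry.AbelianSchemes

end
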